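/- Free-seat work of EXTRA WIDTH SEAT `ym-line-cbag-p1-w4` (prover-ym-line-cbag-p1-w4-g2-0), route `EguchiKawaiDirectionLadder`
(ideator ym-idea-2, LINE 8), crux `TripleSmallBallMargin` (stmt-QuantumFields-27724), toward stub (b) `OffBlockDecoupling`
(ingredient 5, first half, of the honest reduction (b♯) in the sizing note `sizing-27724-stubB.md` attached to the item).
ROUTE-INDEPENDENT (no Theses import).  Nothing here bears on the Yang–Mills mass gap. -/
import Literature.Barriers.QuantumFields.EguchiKawaiBreakdownLowerBound
import HarnessLib

/-!
# Route `EguchiKawaiDirectionLadder`: block compressions of unitaries and of commutators (`Matrix.toBlock` algebra)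

The within-band / within-cluster level of the K_A crux meets COMPRESSIONS `(U_μ)_{II} = U_μ.toBlock p p` of the Haar
links to an index window `I = {p}` (in the eigenbasis of the first link).  This file keeps the books of such
compressions, for `Matrix.toBlock` with predicates and, where a whole block structure is needed, for a LABELLING
`c : n → ι` of the indices (blocks = fibres `{j // c j = a}`):

* `toBlock_mul_eq_sum_fiber` — `(A B).toBlock p r = Σ_a A.toBlock p (c = a) · B.toBlock (c = a) r` (product through a
  labelled middle index; Mathlib's `toBlock_mul_eq_add` is the two-label case);
* GRAM IDENTITIES of a unitary `U ∈ U(N)`: rows — `U_{pq} U_{pq}† + U_{p¬q} U_{p¬q}† = 1` and `Σ_a U_{p,a} U_{p,a}† = 1`;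
  columns — `U_{qp}† U_{qp} + U_{¬q p}† U_{¬q p} = 1`; hence the UNITARY DEFECT of a compression
  `1 − U_{pp} U_{pp}† = U_{p¬p} U_{p¬p}† = Σ_{a ≠ a₀} U_{p,a} U_{p,a}†` (`p = (c = a₀)`), positive semidefinite, of trace
  `Σ_{i ∈ p, j ∉ p} |U_{ij}|²` (the off-block ROW MASS) and, label by label, of rank `≤ #{j | c j = a}` — the split
  «far labels: small trace / near labels: small rank» of the sizing note;
* COMMUTATORS: `[X,Y]_{pp} = [X_{pp}, Y_{pp}] + (X_{p¬p} Y_{¬p p} − Y_{p¬p} X_{¬p p})` and the labelled form, in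
  particular for `ekComm U μ ν`;
* FROBENIUS bookkeeping: `Σ_{ij} |M_{ij}|²` splits over the four blocks of `(p, q)`, so every block has
  `Σ |(M.toBlock p q)_{ij}|² ≤ frobSq M`; `tr(A A†) = Σ_{ij} |A_{ij}|²`;
* RANK bookkeeping: `rank(A + B) ≤ rank A + rank B`, `rank(A A†) ≤ #cols`, `rank(Σ_a M_a) ≤ Σ_a rank M_a`.

HONEST FRAMING: finite-dimensional linear algebra only; no measure, no small-ball estimate.  The route bears on the
barrier-ledger fact `EguchiKawaiBreakdown` only.
-/

set_option autoImplicit false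

noncomputable section

open scoped Matrix ComplexConjugate ComplexOrder
open Literature.Barriers.QuantumFields

namespace Summit.QuantumFields.YangMills.Theorems.EguchiKawaiDirectionLadder

/-! ### §1 `toBlock` algebra over a general ring -/

section ToBlock

variable {l m n R : Type*} [CommRing R]

/-- Blocks of a difference. -/
theorem toBlock_sub (A B : Matrix l m R) (p : l → Prop) (q : m → Prop) :
    (A - B).toBlock p q = A.toBlock p q - B.toBlock p q := rfl

/-- Blocks of a sum. -/
theorem toBlock_add (A B : Matrix l m R) (p : l → Prop) (q : m → Prop) :
    (A + B).toBlock p q = A.toBlock p q + B.toBlock p q := rfl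

/-- The conjugate transpose of a block is the transposed block of the conjugate transpose. -/
theorem toBlock_conjTranspose [StarRing R] (M : Matrix l m R) (p : l → Prop) (q : m → Prop) :
    (M.toBlock p q)ᴴ = Mᴴ.toBlock q p := rfl

/-- **Product through a labelled middle index**: `(A B).toBlock p r = Σ_a A.toBlock p (c = a) · B.toBlock (c = a) r`. -/
theorem toBlock_mul_eq_sum_fiber [Fintype m] {ι : Type*} [Fintype ι] [DecidableEq ι] (c : m → ι)
    (p : l → Prop) (r : n → Prop) (A : Matrix l m R) (B : Matrix m n R) :
    (A * B).toBlock p r = ∑ a, A.toBlock p (fun j => c j = a) * B.toBlock (fun j => c j = a) r := by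
  ext i k
  simp only [Matrix.toBlock_apply, Matrix.mul_apply, Matrix.sum_apply]
  exact (Fintype.sum_fiberwise c (fun j => A (i : l) j * B j (k : n))).symm

/-- **Compression of a commutator** (two labels): `[X,Y]_{pp} = [X_{pp},Y_{pp}] + (X_{p¬p}Y_{¬p p} − Y_{p¬p}X_{¬p p})`. -/
theorem toBlock_commutator [Fintype m] (X Y : Matrix m m R) (p : m → Prop) [DecidablePred p] :
    (X * Y - Y * X).toBlock p p =
      (X.toBlock p p * Y.toBlock p p - Y.toBlock p p * X.toBlock p p) +
        (X.toBlock p (fun i => ¬p i) * Y.toBlock (fun i => ¬p i) p -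
          Y.toBlock p (fun i => ¬p i) * X.toBlock (fun i => ¬p i) p) := by
  rw [toBlock_sub, Matrix.toBlock_mul_eq_add p p p X Y, Matrix.toBlock_mul_eq_add p p p Y X]
  abel

/-- Compression of a commutator, labelled form: `[X,Y]_{pp} = Σ_a (X_{p,a} Y_{a,p} − Y_{p,a} X_{a,p})`. -/
theorem toBlock_commutator_eq_sum_fiber [Fintype m] {ι : Type*} [Fintype ι] [DecidableEq ι] (c : m → ι)
    (X Y : Matrix m m R) (p : m → Prop) :
    (X * Y - Y * X).toBlock p p =
      ∑ a, (X.toBlock p (fun j => c j = a) * Y.toBlock (fun j => c j = a) p -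
        Y.toBlock p (fun j => c j = a) * X.toBlock (fun j => c j = a) p) := by
  rw [toBlock_sub, toBlock_mul_eq_sum_fiber c p p X Y, toBlock_mul_eq_sum_fiber c p p Y X,
    Finset.sum_sub_distrib]

end ToBlock

/-! ### §2 Gram identities and the unitary defect of a compression of `U ∈ U(N)` -/

section Unitary

variable {N : ℕ}

/-- `U U† = 1` for `U ∈ U(N)` (coerced matrices). -/
theorem coe_mul_conjTranspose_self (U : UN N) :
    (U : Matrix (Fin N) (Fin N) ℂ) * (U : Matrix (Fin N) (Fin N) ℂ)ᴴ = 1 := by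
  have h := Matrix.mem_unitaryGroup_iff.mp U.2
  rwa [Matrix.star_eq_conjTranspose] at h

/-- `U† U = 1` for `U ∈ U(N)` (coerced matrices). -/
theorem coe_conjTranspose_mul_self (U : UN N) :
    (U : Matrix (Fin N) (Fin N) ℂ)ᴴ * (U : Matrix (Fin N) (Fin N) ℂ) = 1 := by
  have h := Matrix.mem_unitaryGroup_iff'.mp U.2
  rwa [Matrix.star_eq_conjTranspose] at h

/-- **Row Gram identity (two labels)**: `U_{pq} U_{pq}† + U_{p¬q} U_{p¬q}† = 1_{pp}`. -/
theorem gram_rows_two (U : UN N) (p q : Fin N → Prop) [DecidablePred q] :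
    (U : Matrix (Fin N) (Fin N) ℂ).toBlock p q * ((U : Matrix (Fin N) (Fin N) ℂ).toBlock p q)ᴴ +
      (U : Matrix (Fin N) (Fin N) ℂ).toBlock p (fun i => ¬q i) *
        ((U : Matrix (Fin N) (Fin N) ℂ).toBlock p (fun i => ¬q i))ᴴ = 1 := by
  rw [toBlock_conjTranspose, toBlock_conjTranspose, ← Matrix.toBlock_mul_eq_add p q p,
    coe_mul_conjTranspose_self, Matrix.toBlock_one_self]

/-- **Column Gram identity (two labels)**: `U_{qp}† U_{qp} + U_{¬q p}† U_{¬q p} = 1_{pp}`. -/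
theorem gram_cols_two (U : UN N) (p q : Fin N → Prop) [DecidablePred q] :
    ((U : Matrix (Fin N) (Fin N) ℂ).toBlock q p)ᴴ * (U : Matrix (Fin N) (Fin N) ℂ).toBlock q p +
      ((U : Matrix (Fin N) (Fin N) ℂ).toBlock (fun i => ¬q i) p)ᴴ *
        (U : Matrix (Fin N) (Fin N) ℂ).toBlock (fun i => ¬q i) p = 1 := by
  rw [toBlock_conjTranspose, toBlock_conjTranspose, ← Matrix.toBlock_mul_eq_add p q p,
    coe_conjTranspose_mul_self, Matrix.toBlock_one_self]

/-- **Row Gram identity (labelled)**: `Σ_a U_{p,a} U_{p,a}† = 1_{pp}` for any labelling `c` of the columns. -/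
theorem gram_rows_sum_fiber (U : UN N) {ι : Type*} [Fintype ι] [DecidableEq ι] (c : Fin N → ι)
    (p : Fin N → Prop) :
    ∑ a, (U : Matrix (Fin N) (Fin N) ℂ).toBlock p (fun j => c j = a) *
        ((U : Matrix (Fin N) (Fin N) ℂ).toBlock p (fun j => c j = a))ᴴ = 1 := by
  simp_rw [toBlock_conjTranspose]
  rw [← toBlock_mul_eq_sum_fiber c p p, coe_mul_conjTranspose_self, Matrix.toBlock_one_self]

/-- **Column Gram identity (labelled)**: `Σ_a U_{a,p}† U_{a,p} = 1_{pp}`. -/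
theorem gram_cols_sum_fiber (U : UN N) {ι : Type*} [Fintype ι] [DecidableEq ι] (c : Fin N → ι)
    (p : Fin N → Prop) :
    ∑ a, ((U : Matrix (Fin N) (Fin N) ℂ).toBlock (fun j => c j = a) p)ᴴ *
        (U : Matrix (Fin N) (Fin N) ℂ).toBlock (fun j => c j = a) p = 1 := by
  simp_rw [toBlock_conjTranspose]
  rw [← toBlock_mul_eq_sum_fiber c p p, coe_conjTranspose_mul_self, Matrix.toBlock_one_self]

/-- **The unitary defect of a compression**: `1 − U_{pp} U_{pp}† = U_{p¬p} U_{p¬p}†`. -/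
theorem one_sub_compression_gram (U : UN N) (p : Fin N → Prop) [DecidablePred p] :
    1 - (U : Matrix (Fin N) (Fin N) ℂ).toBlock p p * ((U : Matrix (Fin N) (Fin N) ℂ).toBlock p p)ᴴ =
      (U : Matrix (Fin N) (Fin N) ℂ).toBlock p (fun i => ¬p i) *
        ((U : Matrix (Fin N) (Fin N) ℂ).toBlock p (fun i => ¬p i))ᴴ := by
  rw [← gram_rows_two U p p]; abel

/-- The unitary defect of a compression, labelled form: for the block `p = (c = a₀)`,
`1 − U_{pp} U_{pp}† = Σ_{a ≠ a₀} U_{p,a} U_{p,a}†` — each label contributes a positive semidefinite term of rank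
`≤ #{c = a}` (near labels) and of trace = its Frobenius mass (far labels). -/
theorem one_sub_compression_gram_eq_sum (U : UN N) {ι : Type*} [Fintype ι] [DecidableEq ι]
    (c : Fin N → ι) (a₀ : ι) :
    1 - (U : Matrix (Fin N) (Fin N) ℂ).toBlock (fun j => c j = a₀) (fun j => c j = a₀) *
        ((U : Matrix (Fin N) (Fin N) ℂ).toBlock (fun j => c j = a₀) (fun j => c j = a₀))ᴴ =
      ∑ a ∈ Finset.univ.erase a₀,
        (U : Matrix (Fin N) (Fin N) ℂ).toBlock (fun j => c j = a₀) (fun j => c j = a) *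
          ((U : Matrix (Fin N) (Fin N) ℂ).toBlock (fun j => c j = a₀) (fun j => c j = a))ᴴ := by
  rw [← gram_rows_sum_fiber U c (fun j => c j = a₀), ← Finset.add_sum_erase _ _ (Finset.mem_univ a₀)]
  abel

/-- The defect `U_{pq} U_{pq}†` of any block is positive semidefinite. -/
theorem posSemidef_toBlock_mul_conjTranspose (U : UN N) (p q : Fin N → Prop) [DecidablePred p] [DecidablePred q] :
    ((U : Matrix (Fin N) (Fin N) ℂ).toBlock p q * ((U : Matrix (Fin N) (Fin N) ℂ).toBlock p q)ᴴ).PosSemidef :=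
  Matrix.posSemidef_self_mul_conjTranspose _

/-- Hence `1 − U_{pp} U_{pp}†` is positive semidefinite: a compression of a unitary is a contraction. -/
theorem posSemidef_one_sub_compression_gram (U : UN N) (p : Fin N → Prop) [DecidablePred p] :
    (1 - (U : Matrix (Fin N) (Fin N) ℂ).toBlock p p * ((U : Matrix (Fin N) (Fin N) ℂ).toBlock p p)ᴴ).PosSemidef := by
  rw [one_sub_compression_gram]
  exact posSemidef_toBlock_mul_conjTranspose U p _

/-- **Compression of the Eguchi–Kawai commutator**: `[U_μ,U_ν]_{pp} = [(U_μ)_{pp},(U_ν)_{pp}] + cross terms`. -/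
theorem toBlock_ekComm {d : ℕ} (U : EKConfig d N) (μ ν : Fin d) (p : Fin N → Prop) [DecidablePred p] :
    (ekComm U μ ν).toBlock p p =
      ((U μ : Matrix (Fin N) (Fin N) ℂ).toBlock p p * (U ν : Matrix (Fin N) (Fin N) ℂ).toBlock p p -
          (U ν : Matrix (Fin N) (Fin N) ℂ).toBlock p p * (U μ : Matrix (Fin N) (Fin N) ℂ).toBlock p p) +
        ((U μ : Matrix (Fin N) (Fin N) ℂ).toBlock p (fun i => ¬p i) *
            (U ν : Matrix (Fin N) (Fin N) ℂ).toBlock (fun i => ¬p i) p -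
          (U ν : Matrix (Fin N) (Fin N) ℂ).toBlock p (fun i => ¬p i) *
            (U μ : Matrix (Fin N) (Fin N) ℂ).toBlock (fun i => ¬p i) p) :=
  toBlock_commutator _ _ p

end Unitary

/-! ### §3 Frobenius bookkeeping -/

section Frobenius

variable {m n : Type*} [Fintype m] [Fintype n]

/-- `Σ_{ij} |M_{ij}|²` splits over the rows `p` / `¬p`. -/
theorem sum_norm_sq_split_rows (M : Matrix m n ℂ) (p : m → Prop) [DecidablePred p] :
    ∑ i, ∑ j, ‖M i j‖ ^ 2 =
      (∑ i : {i // p i}, ∑ j, ‖M i j‖ ^ 2) + ∑ i : {i // ¬p i}, ∑ j, ‖M i j‖ ^ 2 :=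
  (Fintype.sum_subtype_add_sum_subtype p (fun i => ∑ j, ‖M i j‖ ^ 2)).symm

/-- `Σ_{ij} |M_{ij}|²` splits over the columns `q` / `¬q`. -/
theorem sum_norm_sq_split_cols {α : Type*} [Fintype α] (M : Matrix α n ℂ) (q : n → Prop) [DecidablePred q] :
    ∑ i, ∑ j, ‖M i j‖ ^ 2 =
      (∑ i, ∑ j : {j // q j}, ‖M i j‖ ^ 2) + ∑ i, ∑ j : {j // ¬q j}, ‖M i j‖ ^ 2 := by
  rw [← Finset.sum_add_distrib]
  refine Finset.sum_congr rfl fun i _ => ?_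
  exact (Fintype.sum_subtype_add_sum_subtype q (fun j => ‖M i j‖ ^ 2)).symm

/-- **Four-block splitting** of the Frobenius mass: `Σ_{ij}|M_{ij}|² = (pq) + (p¬q) + (¬p q) + (¬p ¬q)` blocks. -/
theorem sum_norm_sq_eq_four_blocks (M : Matrix m n ℂ) (p : m → Prop) (q : n → Prop) [DecidablePred p]
    [DecidablePred q] :
    ∑ i, ∑ j, ‖M i j‖ ^ 2 =
      (∑ i, ∑ j, ‖M.toBlock p q i j‖ ^ 2) + (∑ i, ∑ j, ‖M.toBlock p (fun j => ¬q j) i j‖ ^ 2) +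
        ((∑ i, ∑ j, ‖M.toBlock (fun i => ¬p i) q i j‖ ^ 2) +
          ∑ i, ∑ j, ‖M.toBlock (fun i => ¬p i) (fun j => ¬q j) i j‖ ^ 2) := by
  simp only [Matrix.toBlock_apply]
  rw [sum_norm_sq_split_rows M p,
    sum_norm_sq_split_cols (fun (i : {i // p i}) j => M i j) q,
    sum_norm_sq_split_cols (fun (i : {i // ¬p i}) j => M i j) q]

/-- Every block carries at most the total Frobenius mass. -/
theorem sum_norm_sq_toBlock_le (M : Matrix m n ℂ) (p : m → Prop) (q : n → Prop) [DecidablePred p]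
    [DecidablePred q] : ∑ i, ∑ j, ‖M.toBlock p q i j‖ ^ 2 ≤ ∑ i, ∑ j, ‖M i j‖ ^ 2 := by
  rw [sum_norm_sq_eq_four_blocks M p q]
  have h1 : 0 ≤ ∑ i, ∑ j, ‖M.toBlock p (fun j => ¬q j) i j‖ ^ 2 := by positivity
  have h2 : 0 ≤ ∑ i, ∑ j, ‖M.toBlock (fun i => ¬p i) q i j‖ ^ 2 := by positivity
  have h3 : 0 ≤ ∑ i, ∑ j, ‖M.toBlock (fun i => ¬p i) (fun j => ¬q j) i j‖ ^ 2 := by positivity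
  linarith

/-- For square `N × N` matrices the total is the tree's `frobSq`: every block of `M` has mass `≤ frobSq M`. -/
theorem sum_norm_sq_toBlock_le_frobSq {N : ℕ} (M : Matrix (Fin N) (Fin N) ℂ) (p q : Fin N → Prop)
    [DecidablePred p] [DecidablePred q] : ∑ i, ∑ j, ‖M.toBlock p q i j‖ ^ 2 ≤ frobSq M :=
  sum_norm_sq_toBlock_le M p q

/-- `tr(A A†) = Σ_{ij} |A_{ij}|²` (as a complex number). -/
theorem trace_mul_conjTranspose_eq_sum (A : Matrix m n ℂ) :
    Matrix.trace (A * Aᴴ) = ((∑ i, ∑ j, ‖A i j‖ ^ 2 : ℝ) : ℂ) := by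
  simp only [Matrix.trace, Matrix.diag_apply, Matrix.mul_apply, Matrix.conjTranspose_apply,
    Complex.star_def, Complex.mul_conj, Complex.normSq_eq_norm_sq]
  push_cast
  rfl

/-- `Re tr(A A†) = Σ_{ij} |A_{ij}|²`. -/
theorem re_trace_mul_conjTranspose_eq_sum (A : Matrix m n ℂ) :
    (Matrix.trace (A * Aᴴ)).re = ∑ i, ∑ j, ‖A i j‖ ^ 2 := by
  rw [trace_mul_conjTranspose_eq_sum, Complex.ofReal_re]

end Frobenius

/-! ### §4 Rank bookkeeping -/

section Rank

variable {m n : Type*} [Fintype n]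

/-- Subadditivity of the rank: `rank(A + B) ≤ rank A + rank B`. -/
theorem rank_add_le (A B : Matrix m n ℂ) : (A + B).rank ≤ A.rank + B.rank := by
  classical
  unfold Matrix.rank
  rw [Matrix.mulVecLin_add]
  calc Module.finrank ℂ (LinearMap.range (A.mulVecLin + B.mulVecLin))
      ≤ Module.finrank ℂ (LinearMap.range A.mulVecLin ⊔ LinearMap.range B.mulVecLin : Submodule ℂ (m → ℂ)) := by
        apply Submodule.finrank_mono
        rintro x ⟨y, rfl⟩
        exact Submodule.add_mem_sup ⟨y, rfl⟩ ⟨y, rfl⟩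
    _ ≤ Module.finrank ℂ (LinearMap.range A.mulVecLin) + Module.finrank ℂ (LinearMap.range B.mulVecLin) :=
        Submodule.finrank_add_le_finrank_add_finrank _ _

/-- Rank of a finite sum: `rank(Σ_{a∈s} M_a) ≤ Σ_{a∈s} rank M_a`. -/
theorem rank_sum_le {ι : Type*} (s : Finset ι) (M : ι → Matrix m n ℂ) :
    (∑ a ∈ s, M a).rank ≤ ∑ a ∈ s, (M a).rank := by
  classical
  induction s using Finset.induction_on with
  | empty => simp
  | insert a s ha ih =>
    rw [Finset.sum_insert ha, Finset.sum_insert ha]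
    exact (rank_add_le _ _).trans (by gcongr)

/-- A Gram matrix `A A†` has rank at most the number of columns of `A` (the near-label count of the sizing note). -/
theorem rank_mul_conjTranspose_le_card [Fintype m] (A : Matrix m n ℂ) : (A * Aᴴ).rank ≤ Fintype.card n :=
  (Matrix.rank_mul_le_left _ _).trans (Matrix.rank_le_card_width _)

/-- `rank(−B) = rank B`. -/
theorem rank_neg (B : Matrix m n ℂ) : (-B).rank = B.rank := by
  unfold Matrix.rank
  have h : (-B).mulVecLin = -B.mulVecLin := by
    refine LinearMap.ext fun v => ?_
    simp
  rw [h, LinearMap.range_neg]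

/-- Rank of a difference: `rank(A − B) ≤ rank A + rank B`. -/
theorem rank_sub_le (A B : Matrix m n ℂ) : (A - B).rank ≤ A.rank + B.rank := by
  rw [sub_eq_add_neg]
  refine (rank_add_le _ _).trans ?_
  rw [rank_neg]

end Rank

end Summit.QuantumFields.YangMills.Theorems.EguchiKawaiDirectionLadder

end
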